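import Summits.AtomisticToContinuum.HydrodynamicLimit.Theorems.EnskogAdjointDualityAdjointEnskogTestFamilyRTransferBoundPointwise
import Summits.AtomisticToContinuum.HydrodynamicLimit.Theorems.EnskogAdjointDualityAdjointEnskogTestFamilyRTransferBoundAngular
import Summits.AtomisticToContinuum.HydrodynamicLimit.Theorems.EnskogAdjointDualityAdjointEnskogTestFamilyRTransferBoundMeasurable
import HarnessLib

/-!
# K2R transfer bound VI: the `O(ε²)` estimate on a time slice

Route `EnskogAdjointDuality` of `AtomisticToContinuum/HydrodynamicLimit`, crux `AdjointEnskogTestFamilyR`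
(stmt-AtomisticToContinuum-11592, "K2R"), line `birth`, stub `stub_transferBound` (G3b), helper VI.

For one time slice — continuous background `(ρ₀, θ₀, u₀)` in a compact parameter range and Lipschitz in
`x`, a bounded Lipschitz contact factor `Yc`, bounded Lipschitz coefficients `c₀ = (α, β, γ)`, the smooth
weight `W = Yc ρ₀² θ₀` with Lipschitz gradients of `W` and `W uⱼ` — the reduced collisional transfer
`T₀(ε) = ∫_{S²}∫_{𝕋³} −Yc(x+εω/2)ρ₀(x)ρ₀(x+εω)[(β(x)−β(x+εω))·ω J₁ + (γ(x)−γ(x+εω)) J₂] dx dσ(ω)`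
satisfies `|T₀(ε)/2 + (2π/3) ε ∫ (β·∇W + γ div(W u₀))| ≤ K' ε²` for `0 < ε ≤ 1`, with `K'` depending only on
the window constants (helpers II–IV: pointwise replacement, spatial/angular averaging, measurability).

* `k2r_tb_assembly` — the abstract measure-theoretic assembly on `S² × 𝕋³`;
* `k2r_tb_slice` — the slice estimate (registered sub-goal `stub_transferBound_slice`).

References: C. Cercignani, R. Illner, M. Pulvirenti, *The Mathematical Theory of Dilute Gases* (1994),
§3.1 [CIP1994]; S. Chapman, T. G. Cowling, *The Mathematical Theory of Non-uniform Gases* (1970), §16.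
-/

noncomputable section

open MeasureTheory Metric Set Filter Topology Function
open scoped InnerProductSpace BigOperators

namespace Summit.AtomisticToContinuum.HydrodynamicLimit.Theorems.EnskogAdjointDuality

open Literature.Analysis.FluidPDE Literature.MathematicalPhysics.KineticTheory Literature.Analysis.FunctionSpaces

/-! ## Abstract assembly -/

/-- **Abstract assembly of the `O(ε²)` estimate on `S² × 𝕋³`.** Let `F` be strongly measurable and bounded
on `S² × 𝕋³`, `F₀(ω, ·)` integrable on `𝕋³` for every `ω`, `B` integrable on `S²`; if
`|F(ω,x) − F₀(ω,x)| ≤ a` pointwise and `|∫ F₀(ω,·) + ε B(ω)| ≤ a'` for every `ω`, then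
`|∫_{S²}∫_{𝕋³} F + ε ∫_{S²} B| ≤ (a + a') σ(S²)`. [folklore] -/
theorem k2r_tb_assembly {F : sphere (0 : V3) 1 × T3 → ℝ} (hF : StronglyMeasurable F) {FB : ℝ}
    (hFB : ∀ p, |F p| ≤ FB) {F₀ : sphere (0 : V3) 1 → T3 → ℝ} (hF₀ : ∀ ω, Integrable (F₀ ω))
    {B : sphere (0 : V3) 1 → ℝ} (hB : Integrable B (sphereMeasure : Measure (sphere (0 : V3) 1)))
    {a a' ε : ℝ} (hpt : ∀ ω x, |F (ω, x) - F₀ ω x| ≤ a) (hsp : ∀ ω, |(∫ x, F₀ ω x) + ε * B ω| ≤ a') :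
    |(∫ ω, (∫ x, F (ω, x)) ∂(sphereMeasure : Measure (sphere (0 : V3) 1))) +
        ε * ∫ ω, B ω ∂(sphereMeasure : Measure (sphere (0 : V3) 1))| ≤
      (a + a') * (sphereMeasure : Measure (sphere (0 : V3) 1)).real univ := by
  haveI := isFiniteMeasure_sphereMeasure (E := V3)
  obtain ⟨hsec, -, hmarg⟩ := k2r_tb_integrable_sections hF hFB
  -- per direction
  have hω : ∀ ω, |(∫ x, F (ω, x)) + ε * B ω| ≤ a + a' := by
    intro ω
    have h1 : |(∫ x, F (ω, x)) - ∫ x, F₀ ω x| ≤ a := by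
      rw [← integral_sub (hsec ω) (hF₀ ω)]
      have h := norm_integral_le_of_norm_le_const (μ := (volume : Measure T3))
        (f := fun x => F (ω, x) - F₀ ω x) (C := a)
        (Eventually.of_forall fun x => by rw [Real.norm_eq_abs]; exact hpt ω x)
      rwa [probReal_univ, mul_one, Real.norm_eq_abs] at h
    have he : (∫ x, F (ω, x)) + ε * B ω = ((∫ x, F (ω, x)) - ∫ x, F₀ ω x) + ((∫ x, F₀ ω x) + ε * B ω) := by
      ring
    rw [he]
    exact (abs_add_le _ _).trans (add_le_add h1 (hsp ω))
  -- integrate over the sphere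
  rw [← integral_const_mul, ← integral_add hmarg (hB.const_mul ε)]
  have h := norm_integral_le_of_norm_le_const (μ := (sphereMeasure : Measure (sphere (0 : V3) 1)))
    (f := fun ω => (∫ x, F (ω, x)) + ε * B ω) (C := a + a')
    (Eventually.of_forall fun ω => by rw [Real.norm_eq_abs]; exact hω ω)
  rwa [Real.norm_eq_abs] at h

/-! ## The slice estimate -/

/-- **The `O(ε²)` transfer estimate on a time slice.** Continuous background `(ρ₀, θ₀, u₀)` with
`0 ≤ ρ₀ ≤ R`, `θm ≤ θ₀ ≤ Θ`, `‖u₀‖ ≤ U`, `Lb`-Lipschitz; continuous contact factor `|Yc| ≤ Ȳ`, `LY`-Lipschitz;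
continuous coefficients `c₀ = (α, β, γ)`, `‖c₀‖ ≤ C`, `C`-Lipschitz; the weight `W = Yc ρ₀² θ₀` and the `W uⱼ`
smooth with `K₂`-Lipschitz gradients; `K_J` the Lipschitz constant of the Gaussian pair integrals (stub B3a
(iii)).  Then for `0 < ε ≤ 1`, with `y = x + εω`,
`|½ ∫_{S²}∫ −Yc(x+εω/2)ρ₀(x)ρ₀(y)[(β(x)−β(y))·ω J₁ + (γ(x)−γ(y)) J₂] dx dσ + (2π/3) ε ∫ (β·∇W + γ div(W u₀))|`
`≤ (σ(S²)/2)(|K_A| + |6K₂C|) ε²` (pointwise replacement, componentwise finite differences, angular averages,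
Fubini). [cite: CIP1994, §3.1] -/
theorem k2r_tb_slice {θm Θ U R Lb Yb LY K₂ C KJ : ℝ} (hθm : 0 < θm) (hLb : 0 ≤ Lb) (hLY : 0 ≤ LY)
    (hKJ0 : 0 ≤ KJ) {ρ₀ θ₀ : T3 → ℝ} {u₀ : T3 → V3} {Yc W : T3 → ℝ} {c₀ : T3 → ℝ × V3 × ℝ}
    (hρc : Continuous ρ₀) (hθc : Continuous θ₀) (huc : Continuous u₀) (hYc : Continuous Yc)
    (hcc : Continuous c₀)
    (hρ : ∀ x, 0 ≤ ρ₀ x ∧ ρ₀ x ≤ R) (hθ : ∀ x, θm ≤ θ₀ x ∧ θ₀ x ≤ Θ) (hu : ∀ x, ‖u₀ x‖ ≤ U)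
    (hLip : ∀ x x', |ρ₀ x - ρ₀ x'| ≤ Lb * dist x x' ∧ |θ₀ x - θ₀ x'| ≤ Lb * dist x x' ∧
      ‖u₀ x - u₀ x'‖ ≤ Lb * dist x x')
    (hY : ∀ x, |Yc x| ≤ Yb) (hYL : ∀ x x', |Yc x - Yc x'| ≤ LY * dist x x')
    (hc : ∀ x x', ‖c₀ x‖ ≤ C ∧ dist (c₀ x) (c₀ x') ≤ C * dist x x')
    (hWdef : ∀ x, W x = Yc x * ρ₀ x ^ 2 * θ₀ x) (hW : Torus.IsSmooth W)
    (hWu : ∀ j : Fin 3, Torus.IsSmooth (fun y => W y * u₀ y j))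
    (hK : ∀ x x', ‖Torus.gradient W x - Torus.gradient W x'‖ ≤ K₂ * dist x x')
    (hKu : ∀ (j : Fin 3) x x', ‖Torus.gradient (fun y => W y * u₀ y j) x -
      Torus.gradient (fun y => W y * u₀ y j) x'‖ ≤ K₂ * dist x x')
    (hKJ : ∀ (θ θ' : ℝ) (u u' : V3) (ω : sphere (0 : V3) 1),
      θm ≤ θ → θ ≤ Θ → θm ≤ θ' → θ' ≤ Θ → ‖u‖ ≤ U → ‖u'‖ ≤ U →
      |(∫ v : V3, ∫ w : V3, max ⟪v - w, (ω : V3)⟫_ℝ 0 * ⟪v - w, (ω : V3)⟫_ℝ *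
          (localMaxwellian 1 θ u v * localMaxwellian 1 θ' u' w)) - θ| ≤ KJ * (|θ - θ'| + ‖u - u'‖) ∧
      |(∫ v : V3, ∫ w : V3, max ⟪v - w, (ω : V3)⟫_ℝ 0 * ⟪v - w, (ω : V3)⟫_ℝ * (⟪v + w, (ω : V3)⟫_ℝ / 2) *
          (localMaxwellian 1 θ u v * localMaxwellian 1 θ' u' w)) - θ * ⟪u, (ω : V3)⟫_ℝ| ≤
        KJ * (|θ - θ'| + ‖u - u'‖))
    {ε : ℝ} (hε0 : 0 < ε) (hε1 : ε ≤ 1) :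
    |(∫ ω : sphere (0 : V3) 1, (∫ x : T3, -(Yc ((Torus.geometry (Fin 3)).translate x ((ε / 2) • (ω : V3))) * ρ₀ x * ρ₀ ((Torus.geometry (Fin 3)).translate x (ε • (ω : V3)))) *
        (⟪(c₀ x).2.1 - (c₀ ((Torus.geometry (Fin 3)).translate x (ε • (ω : V3)))).2.1, (ω : V3)⟫_ℝ *
          (∫ v : V3, ∫ w : V3, max ⟪v - w, (ω : V3)⟫_ℝ 0 * ⟪v - w, (ω : V3)⟫_ℝ *
            (localMaxwellian 1 (θ₀ x) (u₀ x) v * localMaxwellian 1 (θ₀ ((Torus.geometry (Fin 3)).translate x (ε • (ω : V3)))) (u₀ ((Torus.geometry (Fin 3)).translate x (ε • (ω : V3)))) w)) +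
        ((c₀ x).2.2 - (c₀ ((Torus.geometry (Fin 3)).translate x (ε • (ω : V3)))).2.2) *
          (∫ v : V3, ∫ w : V3, max ⟪v - w, (ω : V3)⟫_ℝ 0 * ⟪v - w, (ω : V3)⟫_ℝ * (⟪v + w, (ω : V3)⟫_ℝ / 2) *
            (localMaxwellian 1 (θ₀ x) (u₀ x) v * localMaxwellian 1 (θ₀ ((Torus.geometry (Fin 3)).translate x (ε • (ω : V3)))) (u₀ ((Torus.geometry (Fin 3)).translate x (ε • (ω : V3)))) w)))) ∂sphereMeasure) / 2 +
      2 * Real.pi / 3 * ε * (∫ x : T3, (⟪(c₀ x).2.1, Torus.gradient W x⟫_ℝ + (c₀ x).2.2 * Torus.divergence (fun y => W y • u₀ y) x))| ≤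
      ((sphereMeasure : Measure (sphere (0 : V3) 1)).real univ / 2 *
        (|(2 * (Yb * R * R) * C * (KJ * (2 * Lb)) + (LY * R * R / 2 + Yb * R * Lb) * Θ * C * (1 + U))| + |6 * K₂ * C|)) * ε ^ 2 := by
  have hθpos : ∀ x, 0 < θ₀ x := fun x => hθm.trans_le (hθ x).1
  have hC : 0 ≤ C := (norm_nonneg _).trans (hc 0 0).1
  have hβc : Continuous fun x => (c₀ x).2.1 := by fun_prop
  have hγc : Continuous fun x => (c₀ x).2.2 := by fun_prop
  have hβC : ∀ x, ‖(c₀ x).2.1‖ ≤ C := fun x => (k2r_tb_norm_snd_fst_le _).trans (hc x x).1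
  have hγC : ∀ x, |(c₀ x).2.2| ≤ C := fun x => (k2r_tb_abs_snd_snd_le _).trans (hc x x).1
  -- the integrand `F`, its replacement `F₀`, the first-order term `b`
  set F : sphere (0 : V3) 1 × T3 → ℝ := fun p =>
    -(Yc ((Torus.geometry (Fin 3)).translate p.2 ((ε / 2) • (p.1 : V3))) * ρ₀ p.2 *
        ρ₀ ((Torus.geometry (Fin 3)).translate p.2 (ε • (p.1 : V3)))) *
      (⟪(c₀ p.2).2.1 - (c₀ ((Torus.geometry (Fin 3)).translate p.2 (ε • (p.1 : V3)))).2.1, (p.1 : V3)⟫_ℝ *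
        (∫ v : V3, ∫ w : V3, max ⟪v - w, (p.1 : V3)⟫_ℝ 0 * ⟪v - w, (p.1 : V3)⟫_ℝ *
          (localMaxwellian 1 (θ₀ p.2) (u₀ p.2) v *
            localMaxwellian 1 (θ₀ ((Torus.geometry (Fin 3)).translate p.2 (ε • (p.1 : V3))))
              (u₀ ((Torus.geometry (Fin 3)).translate p.2 (ε • (p.1 : V3)))) w)) +
      ((c₀ p.2).2.2 - (c₀ ((Torus.geometry (Fin 3)).translate p.2 (ε • (p.1 : V3)))).2.2) *
        (∫ v : V3, ∫ w : V3, max ⟪v - w, (p.1 : V3)⟫_ℝ 0 * ⟪v - w, (p.1 : V3)⟫_ℝ *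
          (⟪v + w, (p.1 : V3)⟫_ℝ / 2) *
          (localMaxwellian 1 (θ₀ p.2) (u₀ p.2) v *
            localMaxwellian 1 (θ₀ ((Torus.geometry (Fin 3)).translate p.2 (ε • (p.1 : V3))))
              (u₀ ((Torus.geometry (Fin 3)).translate p.2 (ε • (p.1 : V3)))) w))) with hFdef
  set F₀ : sphere (0 : V3) 1 → T3 → ℝ := fun ω x => (-(W x * ⟪(c₀ x).2.1 - (c₀ ((Torus.geometry (Fin 3)).translate x (ε • (ω : V3)))).2.1, (ω : V3)⟫_ℝ) -
        W x * ⟪u₀ x, (ω : V3)⟫_ℝ * ((c₀ x).2.2 - (c₀ ((Torus.geometry (Fin 3)).translate x (ε • (ω : V3)))).2.2)) with hF₀def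
  set b : sphere (0 : V3) 1 → T3 → ℝ := fun ω x => (⟪(ω : V3), Torus.gradient W x⟫_ℝ * ⟪(c₀ x).2.1, (ω : V3)⟫_ℝ +
        (∑ j, (ω : V3) j * ⟪(ω : V3), Torus.gradient (fun y => W y * u₀ y j) x⟫_ℝ) * (c₀ x).2.2) with hbdef
  -- (1) measurability and the pointwise bounds
  have hFm : StronglyMeasurable F := k2r_tb_stronglyMeasurable_F hρc hθc hθpos huc hYc hcc ε
  have hpt : ∀ ω x, |F (ω, x) - F₀ ω x| ≤ (2 * (Yb * R * R) * C * (KJ * (2 * Lb)) + (LY * R * R / 2 + Yb * R * Lb) * Θ * C * (1 + U)) * ε ^ 2 := fun ω x => by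
    have h := k2r_tb_pointwise hθm hρ hθ hu hLb hLip hY hLY hYL hc hKJ0 hKJ hε0.le x ω
    convert h using 3
    · simp only [hFdef, neg_mul]
    · simp only [hF₀def, hWdef]
  -- (2) uniform bounds on `F₀` and `F`
  have hWb : ∀ x, |W x| ≤ Yb * (R * R) * Θ := fun x => by
    rw [hWdef, abs_mul, abs_mul]
    have h1 : |ρ₀ x ^ 2| ≤ R * R := by
      rw [abs_of_nonneg (sq_nonneg _), sq]
      exact mul_le_mul (hρ x).2 (hρ x).2 (hρ x).1 ((hρ x).1.trans (hρ x).2)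
    have h2 : |θ₀ x| ≤ Θ := by rw [abs_of_nonneg (hθm.le.trans (hθ x).1)]; exact (hθ x).2
    have hYb0 : 0 ≤ Yb := (abs_nonneg _).trans (hY x)
    have hR0 : 0 ≤ R := (hρ x).1.trans (hρ x).2
    exact mul_le_mul (mul_le_mul (hY x) h1 (abs_nonneg _) hYb0) h2 (abs_nonneg _) (by positivity)
  have hF₀b : ∀ ω x, |F₀ ω x| ≤ 2 * C * (Yb * (R * R) * Θ) * (1 + U) := fun ω x => by
    set y : T3 := (Torus.geometry (Fin 3)).translate x (ε • (ω : V3))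
    have hdβ : |⟪(c₀ x).2.1 - (c₀ y).2.1, (ω : V3)⟫_ℝ| ≤ 2 * C :=
      calc |⟪(c₀ x).2.1 - (c₀ y).2.1, (ω : V3)⟫_ℝ| ≤ ‖(c₀ x).2.1 - (c₀ y).2.1‖ := k2r_abs_inner_sphere_le ω _
        _ ≤ ‖(c₀ x).2.1‖ + ‖(c₀ y).2.1‖ := norm_sub_le _ _
        _ ≤ C + C := add_le_add (hβC x) (hβC y)
        _ = 2 * C := by ring
    have hdγ : |(c₀ x).2.2 - (c₀ y).2.2| ≤ 2 * C :=
      calc |(c₀ x).2.2 - (c₀ y).2.2| ≤ |(c₀ x).2.2| + |(c₀ y).2.2| := abs_sub _ _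
        _ ≤ C + C := add_le_add (hγC x) (hγC y)
        _ = 2 * C := by ring
    have huω : |⟪u₀ x, (ω : V3)⟫_ℝ| ≤ U := (k2r_abs_inner_sphere_le ω _).trans (hu x)
    have hU0 : 0 ≤ U := (norm_nonneg _).trans (hu x)
    have hWx := hWb x
    have hW0 : 0 ≤ Yb * (R * R) * Θ := (abs_nonneg _).trans hWx
    simp only [hF₀def]
    calc |-(W x * ⟪(c₀ x).2.1 - (c₀ y).2.1, (ω : V3)⟫_ℝ) - W x * ⟪u₀ x, (ω : V3)⟫_ℝ * ((c₀ x).2.2 - (c₀ y).2.2)|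
        ≤ |-(W x * ⟪(c₀ x).2.1 - (c₀ y).2.1, (ω : V3)⟫_ℝ)| + |W x * ⟪u₀ x, (ω : V3)⟫_ℝ * ((c₀ x).2.2 - (c₀ y).2.2)| :=
          abs_sub _ _
      _ ≤ Yb * (R * R) * Θ * (2 * C) + Yb * (R * R) * Θ * U * (2 * C) := by
          rw [abs_neg, abs_mul, abs_mul, abs_mul]
          exact add_le_add (mul_le_mul hWx hdβ (abs_nonneg _) hW0)
            (mul_le_mul (mul_le_mul hWx huω (abs_nonneg _) hW0) hdγ (abs_nonneg _) (mul_nonneg hW0 hU0))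
      _ = 2 * C * (Yb * (R * R) * Θ) * (1 + U) := by ring
  have hFB : ∀ p, |F p| ≤ 2 * C * (Yb * (R * R) * Θ) * (1 + U) + |(2 * (Yb * R * R) * C * (KJ * (2 * Lb)) + (LY * R * R / 2 + Yb * R * Lb) * Θ * C * (1 + U))| := by
    rintro ⟨ω, x⟩
    have h1 := hpt ω x
    have h2 := hF₀b ω x
    have hε2 : ε ^ 2 ≤ 1 := by nlinarith
    have h3 : (2 * (Yb * R * R) * C * (KJ * (2 * Lb)) + (LY * R * R / 2 + Yb * R * Lb) * Θ * C * (1 + U)) * ε ^ 2 ≤ |(2 * (Yb * R * R) * C * (KJ * (2 * Lb)) + (LY * R * R / 2 + Yb * R * Lb) * Θ * C * (1 + U))| := by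
      calc (2 * (Yb * R * R) * C * (KJ * (2 * Lb)) + (LY * R * R / 2 + Yb * R * Lb) * Θ * C * (1 + U)) * ε ^ 2 ≤ |(2 * (Yb * R * R) * C * (KJ * (2 * Lb)) + (LY * R * R / 2 + Yb * R * Lb) * Θ * C * (1 + U))| * ε ^ 2 := mul_le_mul_of_nonneg_right (le_abs_self _) (sq_nonneg ε)
        _ ≤ |(2 * (Yb * R * R) * C * (KJ * (2 * Lb)) + (LY * R * R / 2 + Yb * R * Lb) * Θ * C * (1 + U))| * 1 := mul_le_mul_of_nonneg_left hε2 (abs_nonneg _)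
        _ = _ := mul_one _
    calc |F (ω, x)| = |F₀ ω x + (F (ω, x) - F₀ ω x)| := by ring_nf
      _ ≤ |F₀ ω x| + |F (ω, x) - F₀ ω x| := abs_add_le _ _
      _ ≤ _ := add_le_add h2 (h1.trans h3)
  -- (3) integrability of `F₀(ω, ·)` and of `B = ∫ b(·, x) dx`; the spatial step
  have hτc : ∀ ω : sphere (0 : V3) 1, Continuous fun x : T3 => (Torus.geometry (Fin 3)).translate x (ε • (ω : V3)) :=
    fun ω => by simp only [Torus.geometry_translate]; fun_prop
  have hWc : Continuous W := hW.continuous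
  have hF₀i : ∀ ω, Integrable (F₀ ω) := fun ω => by
    simp only [hF₀def]
    exact (((hWc.mul ((hβc.sub (hβc.comp (hτc ω))).inner continuous_const)).neg).sub
      ((hWc.mul (huc.inner continuous_const)).mul (hγc.sub (hγc.comp (hτc ω))))).integrable_unitAddTorus
  have hBi : Integrable (fun ω => ∫ x, b ω x) (sphereMeasure : Measure (sphere (0 : V3) 1)) :=
    (k2r_tb_integrable_b hW hWu hβc hγc (u := u₀)).integral_prod_left
  have hsp : ∀ ω, |(∫ x, F₀ ω x) + ε * (fun ω => ∫ x, b ω x) ω| ≤ 6 * K₂ * C * ε ^ 2 := fun ω =>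
    k2r_tb_spatial hW hWu hK hKu hβc hγc hβC hγC ε ω
  -- (4) assembly on `S² × 𝕋³` and the angular average
  have hass := k2r_tb_assembly hFm hFB hF₀i hBi hpt hsp
  have hang : ∫ ω, (fun ω => ∫ x, b ω x) ω ∂(sphereMeasure : Measure (sphere (0 : V3) 1)) =
      4 * Real.pi / 3 * (∫ x : T3, (⟪(c₀ x).2.1, Torus.gradient W x⟫_ℝ + (c₀ x).2.2 * Torus.divergence (fun y => W y • u₀ y) x)) := k2r_tb_angular hW hWu hβc hγc
  have hS0 : 0 ≤ (sphereMeasure : Measure (sphere (0 : V3) 1)).real univ := measureReal_nonneg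
  have he : (∫ ω : sphere (0 : V3) 1, (∫ x : T3, F (ω, x)) ∂sphereMeasure) / 2 + 2 * Real.pi / 3 * ε * (∫ x : T3, (⟪(c₀ x).2.1, Torus.gradient W x⟫_ℝ + (c₀ x).2.2 * Torus.divergence (fun y => W y • u₀ y) x)) =
      (1 / 2 : ℝ) * ((∫ ω : sphere (0 : V3) 1, (∫ x : T3, F (ω, x)) ∂sphereMeasure) +
        ε * ∫ ω, (fun ω => ∫ x, b ω x) ω ∂(sphereMeasure : Measure (sphere (0 : V3) 1))) := by
    rw [hang]; ring
  have hfin : |(∫ ω : sphere (0 : V3) 1, (∫ x : T3, F (ω, x)) ∂sphereMeasure) / 2 + 2 * Real.pi / 3 * ε * (∫ x : T3, (⟪(c₀ x).2.1, Torus.gradient W x⟫_ℝ + (c₀ x).2.2 * Torus.divergence (fun y => W y • u₀ y) x))| ≤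
      ((sphereMeasure : Measure (sphere (0 : V3) 1)).real univ / 2 * (|(2 * (Yb * R * R) * C * (KJ * (2 * Lb)) + (LY * R * R / 2 + Yb * R * Lb) * Θ * C * (1 + U))| + |6 * K₂ * C|)) * ε ^ 2 := by
    rw [he, abs_mul, abs_of_pos (by norm_num : (0 : ℝ) < 1 / 2)]
    refine (mul_le_mul_of_nonneg_left hass (by norm_num)).trans ?_
    have h1 : (2 * (Yb * R * R) * C * (KJ * (2 * Lb)) + (LY * R * R / 2 + Yb * R * Lb) * Θ * C * (1 + U)) * ε ^ 2 ≤ |(2 * (Yb * R * R) * C * (KJ * (2 * Lb)) + (LY * R * R / 2 + Yb * R * Lb) * Θ * C * (1 + U))| * ε ^ 2 := mul_le_mul_of_nonneg_right (le_abs_self _) (sq_nonneg ε)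
    have h2 : 6 * K₂ * C * ε ^ 2 ≤ |6 * K₂ * C| * ε ^ 2 := mul_le_mul_of_nonneg_right (le_abs_self _) (sq_nonneg ε)
    calc (1 / 2 : ℝ) * (((2 * (Yb * R * R) * C * (KJ * (2 * Lb)) + (LY * R * R / 2 + Yb * R * Lb) * Θ * C * (1 + U)) * ε ^ 2 + 6 * K₂ * C * ε ^ 2) * (sphereMeasure : Measure (sphere (0 : V3) 1)).real univ)
        ≤ (1 / 2 : ℝ) * ((|(2 * (Yb * R * R) * C * (KJ * (2 * Lb)) + (LY * R * R / 2 + Yb * R * Lb) * Θ * C * (1 + U))| * ε ^ 2 + |6 * K₂ * C| * ε ^ 2) *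
            (sphereMeasure : Measure (sphere (0 : V3) 1)).real univ) := by
          refine mul_le_mul_of_nonneg_left (mul_le_mul_of_nonneg_right (add_le_add h1 h2) hS0) (by norm_num)
      _ = ((sphereMeasure : Measure (sphere (0 : V3) 1)).real univ / 2 * (|(2 * (Yb * R * R) * C * (KJ * (2 * Lb)) + (LY * R * R / 2 + Yb * R * Lb) * Θ * C * (1 + U))| + |6 * K₂ * C|)) * ε ^ 2 := by
          ring
  exact hfin

/-- **Registered sub-goal `stub_transferBound_slice`** (K2R line `birth`, stub G3b, helper VI): the `O(ε²)`
transfer estimate on a time slice with a constant depending only on the window constants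
(`k2r_tb_slice`), as a closed statement. [cite: CIP1994, §3.1] -/
theorem stub_transferBound_slice :
    ∀ (θm Θ U R Lb Yb LY K₂ C KJ : ℝ), 0 < θm → 0 ≤ Lb → 0 ≤ LY → 0 ≤ KJ → ∃ K' : ℝ, ∀ (ρ₀ θ₀ : UnitAddTorus
    (Fin 3) → ℝ) (u₀ : UnitAddTorus (Fin 3) → EuclideanSpace ℝ (Fin 3)) (Yc W : UnitAddTorus (Fin 3) → ℝ) (c₀
    : UnitAddTorus (Fin 3) → ℝ × EuclideanSpace ℝ (Fin 3) × ℝ), Continuous ρ₀ → Continuous θ₀ → Continuous u₀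
    → Continuous Yc → Continuous c₀ → (∀ x, 0 ≤ ρ₀ x ∧ ρ₀ x ≤ R) → (∀ x, θm ≤ θ₀ x ∧ θ₀ x ≤ Θ) → (∀ x, ‖u₀ x‖
    ≤ U) → (∀ x x', |ρ₀ x - ρ₀ x'| ≤ Lb * dist x x' ∧ |θ₀ x - θ₀ x'| ≤ Lb * dist x x' ∧ ‖u₀ x - u₀ x'‖ ≤ Lb *
    dist x x') → (∀ x, |Yc x| ≤ Yb) → (∀ x x', |Yc x - Yc x'| ≤ LY * dist x x') → (∀ x x', ‖c₀ x‖ ≤ C ∧ dist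
    (c₀ x) (c₀ x') ≤ C * dist x x') → (∀ x, W x = Yc x * ρ₀ x ^ 2 * θ₀ x) →
    Literature.Analysis.FunctionSpaces.Torus.IsSmooth W → (∀ j : Fin 3,
    Literature.Analysis.FunctionSpaces.Torus.IsSmooth (fun y => W y * u₀ y j)) → (∀ x x',
    ‖Literature.Analysis.FunctionSpaces.Torus.gradient W x - Literature.Analysis.FunctionSpaces.Torus.gradient
    W x'‖ ≤ K₂ * dist x x') → (∀ (j : Fin 3) x x', ‖Literature.Analysis.FunctionSpaces.Torus.gradient (fun y
    => W y * u₀ y j) x - Literature.Analysis.FunctionSpaces.Torus.gradient (fun y => W y * u₀ y j) x'‖ ≤ K₂ *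
    dist x x') → (∀ (θ θ' : ℝ) (u u' : EuclideanSpace ℝ (Fin 3)) (ω : Metric.sphere (0 : EuclideanSpace ℝ (Fin
    3)) 1), θm ≤ θ → θ ≤ Θ → θm ≤ θ' → θ' ≤ Θ → ‖u‖ ≤ U → ‖u'‖ ≤ U → |(∫ v : EuclideanSpace ℝ (Fin 3), ∫ w :
    EuclideanSpace ℝ (Fin 3), max (inner ℝ (v - w) ω) 0 * inner ℝ (v - w) ω *
    (Literature.Analysis.FluidPDE.localMaxwellian 1 θ u v * Literature.Analysis.FluidPDE.localMaxwellian 1 θ'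
    u' w)) - θ| ≤ KJ * (|θ - θ'| + ‖u - u'‖) ∧ |(∫ v : EuclideanSpace ℝ (Fin 3), ∫ w : EuclideanSpace ℝ (Fin
    3), max (inner ℝ (v - w) ω) 0 * inner ℝ (v - w) ω * (inner ℝ (v + w) ω / 2) *
    (Literature.Analysis.FluidPDE.localMaxwellian 1 θ u v * Literature.Analysis.FluidPDE.localMaxwellian 1 θ'
    u' w)) - θ * inner ℝ u ω| ≤ KJ * (|θ - θ'| + ‖u - u'‖)) → ∀ (ε : ℝ), 0 < ε → ε ≤ 1 → |(∫ ω : Metric.sphere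
    (0 : EuclideanSpace ℝ (Fin 3)) 1, (∫ x : UnitAddTorus (Fin 3), -(Yc
    ((Literature.Analysis.FluidPDE.Torus.geometry (Fin 3)).translate x ((ε / 2) • (ω : EuclideanSpace ℝ (Fin
    3)))) * ρ₀ x * ρ₀ ((Literature.Analysis.FluidPDE.Torus.geometry (Fin 3)).translate x (ε • (ω :
    EuclideanSpace ℝ (Fin 3))))) * (inner ℝ ((c₀ x).2.1 - (c₀ ((Literature.Analysis.FluidPDE.Torus.geometry
    (Fin 3)).translate x (ε • (ω : EuclideanSpace ℝ (Fin 3))))).2.1) ω * (∫ v : EuclideanSpace ℝ (Fin 3), ∫ w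
    : EuclideanSpace ℝ (Fin 3), max (inner ℝ (v - w) ω) 0 * inner ℝ (v - w) ω *
    (Literature.Analysis.FluidPDE.localMaxwellian 1 (θ₀ x) (u₀ x) v *
    Literature.Analysis.FluidPDE.localMaxwellian 1 (θ₀ ((Literature.Analysis.FluidPDE.Torus.geometry (Fin
    3)).translate x (ε • (ω : EuclideanSpace ℝ (Fin 3))))) (u₀ ((Literature.Analysis.FluidPDE.Torus.geometry
    (Fin 3)).translate x (ε • (ω : EuclideanSpace ℝ (Fin 3))))) w)) + ((c₀ x).2.2 - (c₀
    ((Literature.Analysis.FluidPDE.Torus.geometry (Fin 3)).translate x (ε • (ω : EuclideanSpace ℝ (Fin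
    3))))).2.2) * (∫ v : EuclideanSpace ℝ (Fin 3), ∫ w : EuclideanSpace ℝ (Fin 3), max (inner ℝ (v - w) ω) 0 *
    inner ℝ (v - w) ω * (inner ℝ (v + w) ω / 2) * (Literature.Analysis.FluidPDE.localMaxwellian 1 (θ₀ x) (u₀
    x) v * Literature.Analysis.FluidPDE.localMaxwellian 1 (θ₀ ((Literature.Analysis.FluidPDE.Torus.geometry
    (Fin 3)).translate x (ε • (ω : EuclideanSpace ℝ (Fin 3))))) (u₀
    ((Literature.Analysis.FluidPDE.Torus.geometry (Fin 3)).translate x (ε • (ω : EuclideanSpace ℝ (Fin 3)))))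
    w)))) ∂Literature.MathematicalPhysics.KineticTheory.sphereMeasure) / 2 + 2 * Real.pi / 3 * ε * (∫ x :
    UnitAddTorus (Fin 3), (inner ℝ (c₀ x).2.1 (Literature.Analysis.FunctionSpaces.Torus.gradient W x) + (c₀
    x).2.2 * Literature.Analysis.FunctionSpaces.Torus.divergence (fun y => W y • u₀ y) x))| ≤ K' * ε ^ 2 :=
  fun _ _ _ _ _ _ _ _ _ _ hθm hLb hLY hKJ0 => ⟨_, fun _ _ _ _ _ _ hρc hθc huc hYc hcc hρ hθ hu hLip hY hYL hc
    hWdef hW hWu hK hKu hKJ _ hε0 hε1 => k2r_tb_slice hθm hLb hLY hKJ0 hρc hθc huc hYc hcc hρ hθ hu hLip hY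
      hYL hc hWdef hW hWu hK hKu hKJ hε0 hε1⟩

end Summit.AtomisticToContinuum.HydrodynamicLimit.Theorems.EnskogAdjointDuality

end
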